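import Summits.HubbardSuperconductivity.HubbardSuperconductivity.Theorems.AnisotropyChordTransferFibre3Hole2Agg
import Summits.HubbardSuperconductivity.HubbardSuperconductivity.Theorems.AnisotropyChordTransferFibre3TwoHoleBS
import Summits.HubbardSuperconductivity.HubbardSuperconductivity.Theorems.AnisotropyChordTransferFibre3TwoHoleGapReduce

/-!
# Route `AnisotropyChord` / H0 rotor rung: HOLE₂ per-`L` certificates — SOUNDNESS IV: from the kernel check to `TwoHoleGap L (3/4·ε₁)`

The last link of the per-`L` HOLE₂ certificates (`…Fibre3Hole2Check` / `Interval` / `Green` / `Sound`):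
* `twoHoleGapRealAt_of_check`: `checkParams L = true` and `checkPairWith L … s₁ s₂ = true` give p1's real single-pair Poincaré
  inequality `TwoHoleGapRealAt L g_L 0 (s₁,s₂)` (`…Fibre3TwoHoleGapReduce`) at the certified constant `g_L = gFix L/D ≥ ¾ε₁` —
  via p2's Dirichlet dual bound (`TwoHoleBS.dual_bound`, `guarded_sum_eq`, `sum_conj_chargeOf_mul`, `greenQF_chargeOf`,
  `…Fibre3TorusDirichletDual` / `…Fibre3TwoHoleBS`) applied to the REAL cut test function and the real charge `E_r ψ`, where the
  Birman–Schwinger inequality on the ten slots is `real_cert` (`…Fibre3Hole2Sound`);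
* ★ `twoHoleGap_of_checks`: if the representative separations of a finite set `S` covering every `D₄`-orbit pass the check, then
  `TwoHoleGap L (3/4·eps1 L)` (p1's `twoHoleGap_of_reps` + `twoHoleGap_mono` with `¾ε₁ ≤ g_L`).
The per-`L` instances (`decide` on `checkPair L x y`, coverage by `decide`) live in `…Fibre3Hole2L9`, `…L10`, … .
Prover seat `hubbard-h0-rotor-p3` g3; helper for stmt-HubbardSuperconductivity-19089 (`--supports`, helper class).
WHAT THIS IS NOT: nothing here proves superconductivity in the Hubbard model (rotor TARGET as worded stays FALSE, g15 verdict);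
this closes, per `L`, ONE input (HOLE₂(.75)) of ONE conditional reduction (rung 19089, `gm3_of_hole2`). Mathlib + tree imports only; no sorry.
-/

set_option linter.dupNamespace false
set_option autoImplicit false

namespace Summit.HubbardSuperconductivity.HubbardSuperconductivity.Theorems.AnisotropyChord.Transfer.Fibre3

namespace Hole2

open scoped BigOperators
open Finset

section Cert

variable (L : ℕ) [NeZero L] (s1 s2 : ℕ)

/-- slot index of p2's `Fin 5 ⊕ Fin 5` point labels (`inl i ↦ i`, `inr i ↦ 5 + i`). [folklore] -/
def slotIdx (p : Fin 5 ⊕ Fin 5) : ℕ := ((finSumFinEquiv p : Fin 10) : ℕ)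

/-- the separation `(s₁, s₂)` as a torus site. [folklore] -/
def sT : Tor L := (((s1 : ℕ) : ZMod L), ((s2 : ℕ) : ZMod L))

omit [NeZero L] in
/-- sums over the ten labels are `range 10` sums over slot indices. [folklore] -/
theorem sum_slots {β : Type} [AddCommMonoid β] (F : ℕ → β) :
    ∑ p : Fin 5 ⊕ Fin 5, F (slotIdx p) = ∑ i ∈ range 10, F i := by
  rw [← Fin.sum_univ_eq_sum_range]
  exact Fintype.sum_equiv finSumFinEquiv (fun p => F (slotIdx p)) (fun k => F k) (fun p => rfl)

omit [NeZero L] in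
/-- `L − 1 ≡ −1`. [folklore] -/
theorem cast_L_sub_one (hL : 3 ≤ L) : (((L - 1 : ℕ)) : ZMod L) = -1 := by
  rw [Nat.cast_sub (by omega : 1 ≤ L), ZMod.natCast_self, Nat.cast_one, zero_sub]

omit [NeZero L] in
/-- slot index of a first-cluster label. [folklore] -/
theorem slotIdx_inl (i : Fin 5) : slotIdx (Sum.inl i) = (i : ℕ) := by
  rw [slotIdx, finSumFinEquiv_apply_left, Fin.val_castAdd]

omit [NeZero L] in
/-- slot index of a second-cluster label. [folklore] -/
theorem slotIdx_inr (i : Fin 5) : slotIdx (Sum.inr i) = 5 + (i : ℕ) := by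
  rw [slotIdx, finSumFinEquiv_apply_right, Fin.val_natAdd]

omit [NeZero L] in
-- justification: a ten-way case bash shares one simp set, which no single case uses in full.
set_option linter.unusedSimpArgs false in
/-- ★ p2's ten points of the pair `(0, s)` ARE the checker's slot points. [folklore] -/
theorem bsPt_eq (hL : 3 ≤ L) (p : Fin 5 ⊕ Fin 5) :
    TwoHoleBS.bsPt L 0 (sT L s1 s2) p = ptT L s1 s2 (slotIdx p) := by
  have em1 := cast_L_sub_one L hL
  rcases p with p | p <;> fin_cases p <;>
    simp [TwoHoleBS.bsPt, TwoHoleBS.clusterPt, ptT, slotPt, slotIdx_inl, slotIdx_inr, sT, ex, ey, ZMod.natCast_mod, em1,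
      Prod.ext_iff]

omit [NeZero L] in
/-- the separation vanishes on the torus iff both coordinates are divisible by `L`. [folklore] -/
theorem sT_eq_zero_iff : sT L s1 s2 = 0 ↔ (s1 % L = 0 ∧ s2 % L = 0) := by
  unfold sT
  rw [Prod.mk_eq_zero, ZMod.natCast_eq_zero_iff, ZMod.natCast_eq_zero_iff, Nat.dvd_iff_mod_eq_zero, Nat.dvd_iff_mod_eq_zero]

omit [NeZero L] in
/-- a deleted slot carries `0` or `s`. [folklore] -/
theorem ptT_of_isHole {a : ℕ} (h : isHole L s1 s2 a = true) :
    ptT L s1 s2 a = 0 ∨ ptT L s1 s2 a = sT L s1 s2 := by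
  unfold isHole at h
  rw [Bool.or_eq_true, beq_iff_eq, beq_iff_eq] at h
  unfold ptT
  rcases h with h | h
  · left; rw [h]; simp
  · right; rw [h]; unfold sT; simp [ZMod.natCast_mod]

/-- `Re G̃` with vanishing imaginary part: the Green's function is a real number. [folklore] -/
theorem greenW_eq_ofReal (g : ℝ) (r : Tor L) :
    TwoHoleBS.greenW L g r = (((TwoHoleBS.greenW L g r).re : ℝ) : ℂ) := by
  apply Complex.ext
  · simp
  · rw [Complex.ofReal_im]; exact TwoHoleBS.greenW_im L g r

/-- ★ THE REAL SINGLE-PAIR POINCARÉ INEQUALITY at `g_L` from ANY enclosing interval Green matrix `G` whose aggregate `K2` passes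
the positivity test (`3 ≤ L`, `g_L < ε₁`-check, `s ≢ 0`): `TwoHoleGapRealAt L g_L 0 (s₁,s₂)`. [folklore] -/
theorem twoHoleGapRealAt_of_cert (hL : 3 ≤ L) (hglt' : gFix L < D - (cosIv L 1).2) (hne : ¬ (s1 % L = 0 ∧ s2 % L = 0))
    (G : List (List Iv)) (hG : GEncl L s1 s2 G) (E : ℕ → ℕ → ℤ) (hpsd : psdCheck 10 (k2Mat (KZ L s1 s2 G E)) = true) :
    TwoHoleGapRealAt L (gR L) 0 (sT L s1 s2) := by
  have hs : (0 : Tor L) ≠ sT L s1 s2 := fun h => hne ((sT_eq_zero_iff L s1 s2).mp h.symm)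
  have hglt : gR L < eps1 L := gFix_lt L hL hglt'
  intro u hmean
  -- the real cut test function and its complexification
  set cutU : Tor L → ℝ := fun x => if (x = 0 ∨ x = sT L s1 s2) then 0 else u x with hcutU
  set f : Tor L → ℂ := fun x => ((u x : ℝ) : ℂ) with hf
  have hcut : TwoHoleBS.cut L 0 (sT L s1 s2) f = fun x => ((cutU x : ℝ) : ℂ) := by
    funext x
    unfold TwoHoleBS.cut
    rw [hcutU]
    simp only [hf]
    split_ifs <;> simp
  have hφ1 : TwoHoleBS.cut L 0 (sT L s1 s2) f 0 = 0 := by simp [TwoHoleBS.cut]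
  have hφ2 : TwoHoleBS.cut L 0 (sT L s1 s2) f (sT L s1 s2) = 0 := by simp [TwoHoleBS.cut]
  have hsum : ∑ x : Tor L, TwoHoleBS.cut L 0 (sT L s1 s2) f x = 0 := by
    rw [hcut, ← Complex.ofReal_sum]
    rw [hcutU]
    exact_mod_cast congrArg (fun r : ℝ => (r : ℂ)) hmean
  -- the slot vector and its admissibility
  set w : ℕ → ℝ := fun i => cutU (ptT L s1 s2 i) with hw
  have hrep : ∀ a, a < 10 → w (repOf L s1 s2 a) = w a := by
    intro a _
    simp only [hw, ptT, slotPt_repOf]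
  have hhole : ∀ a, a < 10 → isHole L s1 s2 a = true → w a = 0 := by
    intro a _ ha
    simp only [hw, hcutU]
    rcases ptT_of_isHole L s1 s2 ha with h | h
    · rw [if_pos (Or.inl h)]
    · rw [if_pos (Or.inr h)]
  have key := real_cert L s1 s2 G E hG hpsd w hrep hhole
  -- the complex charge map and the boundary data
  set Ecx : Matrix (Fin 5 ⊕ Fin 5) (Fin 5 ⊕ Fin 5) ℂ := fun p q => ((ER E (slotIdx p) (slotIdx q) : ℝ) : ℂ) with hE
  set ψ : Fin 5 ⊕ Fin 5 → ℂ := TwoHoleBS.restr L 0 (sT L s1 s2) (TwoHoleBS.cut L 0 (sT L s1 s2) f) with hψdef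
  have hψ : ∀ p, ψ p = ((w (slotIdx p) : ℝ) : ℂ) := by
    intro p
    show TwoHoleBS.cut L 0 (sT L s1 s2) f (TwoHoleBS.bsPt L 0 (sT L s1 s2) p) = _
    rw [hcut, bsPt_eq L s1 s2 hL p]
  set v : ℕ → ℝ := fun p => ∑ q ∈ range 10, ER E p q * w q with hv
  have hEψ : ∀ p, Ecx.mulVec ψ p = ((v (slotIdx p) : ℝ) : ℂ) := by
    intro p
    simp only [Matrix.mulVec, dotProduct, hE, hψ]
    rw [show (∑ q : Fin 5 ⊕ Fin 5, ((ER E (slotIdx p) (slotIdx q) : ℝ) : ℂ) * ((w (slotIdx q) : ℝ) : ℂ))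
        = ∑ q : Fin 5 ⊕ Fin 5, (((ER E (slotIdx p) (slotIdx q) * w (slotIdx q) : ℝ)) : ℂ) from
      Finset.sum_congr rfl fun q _ => by push_cast; ring]
    rw [sum_slots (F := fun j => (((ER E (slotIdx p) j * w j : ℝ)) : ℂ)), hv]
    push_cast
    rfl
  -- the Dirichlet dual bound with the charge carried by `E ψ`
  have hd := TwoHoleBS.dual_bound L (by omega) hglt (TwoHoleBS.cut L 0 (sT L s1 s2) f)
    (TwoHoleBS.chargeOf L 0 (sT L s1 s2) (Ecx.mulVec ψ)) hsum
  rw [TwoHoleBS.sum_conj_chargeOf_mul, TwoHoleBS.greenQF_chargeOf] at hd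
  -- read the three complex expressions as real numbers
  have t1 : (∑ p : Fin 5 ⊕ Fin 5, (starRingEnd ℂ) (Ecx.mulVec ψ p)
        * TwoHoleBS.cut L 0 (sT L s1 s2) f (TwoHoleBS.bsPt L 0 (sT L s1 s2) p)).re
      = ∑ i ∈ range 10, v i * w i := by
    have e : ∀ p : Fin 5 ⊕ Fin 5, (starRingEnd ℂ) (Ecx.mulVec ψ p)
        * TwoHoleBS.cut L 0 (sT L s1 s2) f (TwoHoleBS.bsPt L 0 (sT L s1 s2) p)
        = (((v (slotIdx p) * w (slotIdx p) : ℝ)) : ℂ) := by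
      intro p
      rw [hEψ p, show TwoHoleBS.cut L 0 (sT L s1 s2) f (TwoHoleBS.bsPt L 0 (sT L s1 s2) p) = ψ p from rfl, hψ p,
        Complex.conj_ofReal]
      push_cast; ring
    rw [Finset.sum_congr rfl fun p _ => e p, sum_slots (F := fun i => (((v i * w i : ℝ)) : ℂ))]
    rw [← Complex.ofReal_sum, Complex.ofReal_re]
  have t2 : (∑ p : Fin 5 ⊕ Fin 5, ∑ q : Fin 5 ⊕ Fin 5, (starRingEnd ℂ) (Ecx.mulVec ψ p)
        * TwoHoleBS.greenMat L (gR L) 0 (sT L s1 s2) p q * Ecx.mulVec ψ q).re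
      = ∑ i ∈ range 10, ∑ j ∈ range 10, v i * GR L s1 s2 i j * v j := by
    have e : ∀ p q : Fin 5 ⊕ Fin 5, (starRingEnd ℂ) (Ecx.mulVec ψ p)
        * TwoHoleBS.greenMat L (gR L) 0 (sT L s1 s2) p q * Ecx.mulVec ψ q
        = (((v (slotIdx p) * GR L s1 s2 (slotIdx p) (slotIdx q) * v (slotIdx q) : ℝ)) : ℂ) := by
      intro p q
      rw [hEψ p, hEψ q, Complex.conj_ofReal]
      unfold TwoHoleBS.greenMat
      rw [Matrix.of_apply, bsPt_eq L s1 s2 hL p, bsPt_eq L s1 s2 hL q, greenW_eq_ofReal]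
      unfold GR
      push_cast; ring
    rw [Finset.sum_congr rfl fun p _ => Finset.sum_congr rfl fun q _ => e p q]
    rw [show (∑ p : Fin 5 ⊕ Fin 5, ∑ q : Fin 5 ⊕ Fin 5,
          ((((v (slotIdx p) * GR L s1 s2 (slotIdx p) (slotIdx q) * v (slotIdx q) : ℝ)) : ℂ)))
        = ∑ p : Fin 5 ⊕ Fin 5, ((((∑ j ∈ range 10, v (slotIdx p) * GR L s1 s2 (slotIdx p) j * v j : ℝ)) : ℂ)) from
      Finset.sum_congr rfl fun p _ => by
        rw [sum_slots (F := fun j => (((v (slotIdx p) * GR L s1 s2 (slotIdx p) j * v j : ℝ)) : ℂ)), Complex.ofReal_sum]]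
    rw [sum_slots (F := fun i => (((∑ j ∈ range 10, v i * GR L s1 s2 i j * v j : ℝ)) : ℂ)), ← Complex.ofReal_sum,
      Complex.ofReal_re]
  have t3 : ∑ p : Fin 5 ⊕ Fin 5, ‖ψ p‖ ^ 2 = ∑ i ∈ range 10, w i ^ 2 := by
    rw [Finset.sum_congr rfl fun p _ => by rw [hψ p, Complex.norm_real, Real.norm_eq_abs, sq_abs],
      sum_slots (F := fun i => w i ^ 2)]
  -- the boundary mass and the guarded bond sum
  have hnb := TwoHoleBS.nbr_add_nbr L hφ1 hφ2
  have hgs := TwoHoleBS.guarded_sum_eq L hs f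
  rw [t1, t2] at hd
  rw [show TwoHoleBS.restr L 0 (sT L s1 s2) (TwoHoleBS.cut L 0 (sT L s1 s2) f) = ψ from rfl, t3] at hnb
  rw [hnb] at hgs
  -- the two real sides of `TwoHoleGapRealAt`
  have lhs : (∑ x : Tor L, (if (x = 0 ∨ x = sT L s1 s2) then (0 : ℝ) else u x ^ 2))
      = ∑ x : Tor L, ‖TwoHoleBS.cut L 0 (sT L s1 s2) f x‖ ^ 2 := by
    refine Finset.sum_congr rfl fun x _ => ?_
    rw [TwoHoleBS.norm_cut_sq]
    split_ifs
    · rfl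
    · rw [hf]; simp only []; rw [Complex.norm_real, Real.norm_eq_abs, sq_abs]
  have rhs : (∑ x : Tor L, ((nnList L).map (fun e =>
        if (x = 0 ∨ x = sT L s1 s2 ∨ x + e = 0 ∨ x + e = sT L s1 s2) then (0 : ℝ) else (u x - u (x + e)) ^ 2)).sum)
      = ∑ x : Tor L, ((nnList L).map (fun e =>
        if (x = 0 ∨ x = sT L s1 s2 ∨ x + e = 0 ∨ x + e = sT L s1 s2) then (0 : ℝ) else ‖f x - f (x + e)‖ ^ 2)).sum := by
    refine Finset.sum_congr rfl fun x _ => ?_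
    rw [nnList_map_sum, nnList_map_sum]
    have e : ∀ e : Tor L, (if (x = 0 ∨ x = sT L s1 s2 ∨ x + e = 0 ∨ x + e = sT L s1 s2) then (0 : ℝ) else (u x - u (x + e)) ^ 2)
        = (if (x = 0 ∨ x = sT L s1 s2 ∨ x + e = 0 ∨ x + e = sT L s1 s2) then (0 : ℝ) else ‖f x - f (x + e)‖ ^ 2) := by
      intro e
      split_ifs
      · rfl
      · rw [hf]; simp only []; rw [← Complex.ofReal_sub, Complex.norm_real, Real.norm_eq_abs, sq_abs]
    rw [e, e, e, e]
  rw [lhs, rhs, hgs]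
  linarith

/-- ★ FROM THE KERNEL CHECK TO THE REAL SINGLE-PAIR POINCARÉ INEQUALITY at `g_L`:
`checkParams L ∧ checkPairWith L … s₁ s₂ ⇒ TwoHoleGapRealAt L g_L 0 (s₁,s₂)` (the checker's own Green matrix `GI`). [folklore] -/
theorem twoHoleGapRealAt_of_check (hpar : checkParams L = true)
    (hchk : checkPairWith L (cosTab L) (einvTab L (cosTab L) (gFix L)) s1 s2 = true) :
    TwoHoleGapRealAt L (gR L) 0 (sT L s1 s2) := by
  unfold checkParams at hpar
  simp only [Bool.and_eq_true, decide_eq_true_eq] at hpar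
  obtain ⟨⟨⟨⟨hL, _⟩, _⟩, hglt'⟩, hpos⟩ := hpar
  unfold checkPairWith at hchk
  rw [Bool.and_eq_true, decide_eq_true_eq, k2Of_eq] at hchk
  obtain ⟨hne, hpsd⟩ := hchk
  exact twoHoleGapRealAt_of_cert L s1 s2 hL hglt' hne (GI L s1 s2) (gEncl_GI L s1 s2 hL hpos) (eMat L (GI L s1 s2) s1 s2) hpsd

/-- ★★ `TwoHoleGap L (3/4·ε₁)` FROM THE KERNEL CHECKS: if a finite set `S` of separations meets the `D₄`-orbit of every `z ≠ 0`
and every `s ∈ S` is `(s₁, s₂)` with `checkPairWith L … s₁ s₂ = true`, and `checkParams L = true`, then HOLE₂(.75) holds at `L`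
(p1's `twoHoleGap_of_reps`, `twoHoleGap_mono`; `¾ε₁ ≤ g_L`). [folklore] -/
theorem twoHoleGap_of_checks (hpar : checkParams L = true) (S : Finset (Tor L))
    (hcover : ∀ z : Tor L, z ≠ 0 → ∃ s ∈ S, s ∈ d4Orbit L z)
    (hS : ∀ s ∈ S, ∃ a b : ℕ, s = sT L a b ∧ checkPairWith L (cosTab L) (einvTab L (cosTab L) (gFix L)) a b = true) :
    TwoHoleGap L (3 / 4 * eps1 L) := by
  have hL : 3 ≤ L := by
    unfold checkParams at hpar
    simp only [Bool.and_eq_true, decide_eq_true_eq] at hpar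
    exact hpar.1.1.1.1
  refine twoHoleGap_mono L (gFix_ge L hL) (twoHoleGap_of_reps L S hcover fun s hs => ?_)
  obtain ⟨a, b, rfl, hab⟩ := hS s hs
  exact twoHoleGapRealAt_of_check L a b hpar hab

end Cert

end Hole2

end Summit.HubbardSuperconductivity.HubbardSuperconductivity.Theorems.AnisotropyChord.Transfer.Fibre3
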